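import Literature.NumberTheory.EllipticCurves.AnticyclotomicBigGaloisRep
import HarnessLib

/-!
# The `T`-torsion of the big module `M = A ⊗ Λ^*(Ψ⁻¹)` is the module of constant functions
# `≃ A[p^∞]` (with its `G`-action `ρ`), and `M[r] = A[r] ⊗ Λ^*` — PROVED

Topic `Literature/NumberTheory/EllipticCurves`. Theorems only: no definition, no named fact, no
`sorry`, no instance, no notation. Cell `pub/bsd-cited` (ARM P), seat `bsd-cited-r17` (g11): module
F1 of the tree-mapped discharge plan `NOTE-r17-FG-lemma319-discharge-plan` (868cb889e3cf9c9a) for the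
named fact `SkinnerUrban2014.lemma319_finite_XBig` ([SU14] Lemma 3.1.9 = Greenberg's finiteness of
the big Selmer group over `Λ`) — the input «`(T ⊗ Λ^*)[T] = T`, `G`-equivariantly» of its
lift-along-`T` step, on the tree's co-induced model `BigRepModule 𝒪 p A` = smooth `p`-primary
functions `Φ : ℤ_p → A`, `(T·Φ)(x) = Φ(x + 1) - Φ(x)` (`AnticyclotomicBigGaloisRep.lean`, `X_smul`).
The companion input «`T` is ONTO `T ⊗ Λ^*`» is ALREADY the tree's theorem
`BigRepModule.shiftSubOne_surjective` / `exists_shiftSubOne_eq`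
(`Literature/NumberTheory/IwasawaTheory/Greenberg2006/TwistDeformation.lean` §5, cell `bsd-eis`) and
is not restated here; the binomial (Mahler) expansion, `exists_pow_nsmul_eq_zero`,
`shiftSubOne_pow_eq_X_pow_smul`, `nilIndex` and cofreeness live in `Greenberg2006/CoinducedModuleDual.lean`.

Printed statements. [GreenbergLNM1716] §4, before Prop. 4.10 and proofs of Props. 4.9–4.10: "Let
`𝒜 = Hom(Λ, E[p^∞])` … if `θ ∈ Λ`, then `θφ` is defined by `(θφ)(λ) = φ(θλ)` … if `θ` is any nonzero
element of `Λ`, then `𝒜[θ] ≅ Hom(Λ/Λθ, E[p^∞])`" (`θ = T`: `𝒜[T] ≅ Hom(ℤ_p, A) = A`, the constants;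
`θ = p`: `𝒜[p] = Hom(Λ/pΛ, A) = Hom(Λ, A[p])`). [SkinnerUrban2014] §3.1.3 and proof of Prop. 3.2.3:
`Λ^* = lim→_n Hom_ℤ(ℤ[Gal(F_n/F)], ·)`; Lemma 3.1.9 (p. 20) is the consumer. [Castella2018] §2.1–2.2:
"the `G_K`-action on `𝒜` is given by `ρ_{E,p} ⊗ Ψ⁻¹`", "`1 + T ↦ γ`".

Proved here, for a general coefficient ring `𝒪` and `𝒪`-module `A` (no divisibility): §1 `M[T]` =
constants (`apply_eq_apply_zero_of_shiftSubOne_eq_zero` is a twin of the kernel-checked Summits-side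
lemma of the same name, `Theorems/ErratumRoadFiveBigRepInvariants.lean` :146, bsd-stepL imc-p1 g8 —
consolidate on promotion; `shiftSubOne_eq_zero_iff`, `X_smul_eq_zero_iff`, `mem_ker_shiftSubOne_iff`,
`const_mem_bigRepSubmodule_iff`; the `G`-action on constants `bigRep_mk_const` :
`g · const a = const (ρ g a)` — the constants are the copy of `A[p^∞]` with `G` acting through `ρ`);
§2 torsion bookkeeping in `𝒪⟦T⟧`-currency (`exists_X_pow_smul_eq_zero`,
`exists_C_natCast_pow_smul_eq_zero`) and **`M[r] = A[r] ⊗ Λ^*`** (`mem_range_mapRange_iff`,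
`range_mapRange_subtype_torsionBy`: the `r`-torsion of `M` is `mapRange (A[r] ↪ A)` of the big module
of `A[r]`). Conditional on nothing; closes nothing by itself.
-/

noncomputable section

open PowerSeries Literature.NumberTheory.GaloisRepresentations

namespace Literature.NumberTheory.EllipticCurves.BigRepModule

variable {𝒪 : Type*} [CommRing 𝒪] {p : ℕ} [Fact p.Prime] {A : Type*} [AddCommGroup A] [Module 𝒪 A]

/-! ### §1 The `T`-torsion of `M` is the module of constant functions `≃ A[p^∞]` -/

section Constants

/-- A smooth function killed by `T = τ₁ − 1` (`Φ(x + 1) = Φ(x)` for all `x`) is CONSTANT: it is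
constant on the cosets of some `pⁿℤ_p`, each of which contains a natural number, and
`Φ(m) = Φ(0)` for `m ∈ ℕ` by induction. Twin of the Summits-side lemma of the same name in
`Theorems/ErratumRoadFiveBigRepInvariants.lean` :146 (imc-p1 g8); consolidate on promotion.
[cite: GreenbergLNM1716, §4, before Prop. 4.10 (𝒜[θ] ≅ Hom(Λ/Λθ, E[p^∞]); θ = T)] -/
theorem apply_eq_apply_zero_of_shiftSubOne_eq_zero (Φ : BigRepModule 𝒪 p A)
    (hΦ : shiftSubOne Φ = 0) (x : ℤ_[p]) : Φ x = Φ 0 := by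
  have hstep : ∀ y : ℤ_[p], Φ (y + 1) = Φ y := fun y ↦ by
    have h := DFunLike.congr_fun hΦ y
    rw [shiftSubOne_apply, BigRepModule.zero_apply, sub_eq_zero] at h
    exact h
  have hnat : ∀ m : ℕ, Φ (m : ℤ_[p]) = Φ 0 := fun m ↦ by
    induction m with
    | zero => rw [Nat.cast_zero]
    | succ m ih => rw [Nat.cast_succ, hstep, ih]
  obtain ⟨n, hn⟩ := Φ.exists_level
  rw [hn x ((x.appr n : ℕ) : ℤ_[p]) (PadicInt.appr_spec n x), hnat]

/-- `T • Φ = 0 ↔ Φ` is constant (`𝒜[T] = Hom(Λ/ΛT, A) = A`).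
[cite: GreenbergLNM1716, §4, before Prop. 4.10 (𝒜[θ] ≅ Hom(Λ/Λθ, E[p^∞]); θ = T)] -/
theorem shiftSubOne_eq_zero_iff (Φ : BigRepModule 𝒪 p A) :
    shiftSubOne Φ = 0 ↔ ∀ x, Φ x = Φ 0 := by
  refine ⟨apply_eq_apply_zero_of_shiftSubOne_eq_zero Φ, fun h ↦ ?_⟩
  ext x
  rw [shiftSubOne_apply, h (x + 1), h x, sub_self, BigRepModule.zero_apply]

/-- `T • Φ = 0 ↔ Φ` is constant, in `𝒪⟦T⟧`-currency (`T = PowerSeries.X` acts as `τ₁ - 1`).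
[cite: GreenbergLNM1716, §4, before Prop. 4.10 (𝒜[θ] ≅ Hom(Λ/Λθ, E[p^∞]); θ = T)] -/
theorem X_smul_eq_zero_iff (Φ : BigRepModule 𝒪 p A) :
    (PowerSeries.X : PowerSeries 𝒪) • Φ = 0 ↔ ∀ x, Φ x = Φ 0 := by
  rw [X_smul, shiftSubOne_eq_zero_iff]

/-- The constant function `x ↦ a` is a smooth `p`-primary function iff `a` is `p`-power torsion.
[cite: SkinnerUrban2014, §3.1.3 and proof of Prop. 3.2.3 (Λ^* = lim Hom(ℤ[Gal(F_n/F)], ·); the n = 0 term)] -/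
theorem const_mem_bigRepSubmodule_iff (a : A) :
    (fun _ : ℤ_[p] ↦ a) ∈ bigRepSubmodule 𝒪 p A ↔ ∃ k : ℕ, p ^ k • a = 0 :=
  ⟨fun ⟨_, k, hk⟩ ↦ ⟨k, hk 0⟩, fun ⟨k, hk⟩ ↦ ⟨⟨0, fun _ _ _ ↦ rfl⟩, ⟨k, fun _ ↦ hk⟩⟩⟩

/-- `x ↦ Φ 0` is a smooth `p`-primary function (`Φ 0` is `p`-power torsion). [cite: SkinnerUrban2014, §3.1.3 and proof of Prop. 3.2.3 (Λ^* = lim Hom(ℤ[Gal(F_n/F)], ·))] -/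
theorem const_apply_zero_mem_bigRepSubmodule (Φ : BigRepModule 𝒪 p A) :
    (fun _ : ℤ_[p] ↦ Φ 0) ∈ bigRepSubmodule 𝒪 p A :=
  (const_mem_bigRepSubmodule_iff (Φ 0)).2 (Φ.exists_torsion.imp fun _ hk ↦ hk 0)

/-- Additive maps of the values (e.g. `ρ g`) preserve constant smooth functions. [cite: SkinnerUrban2014, §3.1.3 and proof of Prop. 3.2.3 (Λ^* = lim Hom(ℤ[Gal(F_n/F)], ·))] -/
theorem const_map_mem_bigRepSubmodule {A' : Type*} [AddCommGroup A'] [Module 𝒪 A']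
    {F : Type*} [FunLike F A A'] [AddMonoidHomClass F A A'] (L : F) {a : A}
    (h : (fun _ : ℤ_[p] ↦ a) ∈ bigRepSubmodule 𝒪 p A) :
    (fun _ : ℤ_[p] ↦ L a) ∈ bigRepSubmodule 𝒪 p A' := by
  obtain ⟨k, hk⟩ := (const_mem_bigRepSubmodule_iff a).1 h
  exact (const_mem_bigRepSubmodule_iff (L a)).2 ⟨k, by rw [← map_nsmul, hk, map_zero]⟩

/-- Constant functions are killed by `T = τ₁ - 1`. [cite: GreenbergLNM1716, §4, before Prop. 4.10 (𝒜[θ] ≅ Hom(Λ/Λθ, E[p^∞]); θ = T)] -/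
theorem shiftSubOne_mk_const (a : A) (h : (fun _ : ℤ_[p] ↦ a) ∈ bigRepSubmodule 𝒪 p A) :
    shiftSubOne (BigRepModule.mk (fun _ : ℤ_[p] ↦ a) h) = 0 := by
  ext x
  rw [shiftSubOne_apply, BigRepModule.mk_apply, BigRepModule.mk_apply, sub_self,
    BigRepModule.zero_apply]

/-- A function killed by `T` IS the constant function at its value `Φ 0`. [cite: GreenbergLNM1716, §4, before Prop. 4.10 (𝒜[θ] ≅ Hom(Λ/Λθ, E[p^∞]); θ = T)] -/
theorem eq_mk_const_of_shiftSubOne_eq_zero (Φ : BigRepModule 𝒪 p A) (hΦ : shiftSubOne Φ = 0) :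
    Φ = BigRepModule.mk (fun _ : ℤ_[p] ↦ Φ 0) Φ.const_apply_zero_mem_bigRepSubmodule :=
  BigRepModule.ext fun x ↦ by
    rw [BigRepModule.mk_apply]
    exact apply_eq_apply_zero_of_shiftSubOne_eq_zero Φ hΦ x

/-- **`M[T]` = the constant functions**: `Φ ∈ ker (τ₁ - 1)` iff `Φ = (x ↦ a)` for a (necessarily
`p`-power-torsion) `a ∈ A` (`𝒜[T] ≅ Hom(Λ/ΛT, A) ≅ A[p^∞]`).
[cite: GreenbergLNM1716, §4, before Prop. 4.10 (𝒜[θ] ≅ Hom(Λ/Λθ, E[p^∞]); θ = T)] -/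
theorem mem_ker_shiftSubOne_iff (Φ : BigRepModule 𝒪 p A) :
    Φ ∈ LinearMap.ker (shiftSubOne : BigRepModule 𝒪 p A →ₗ[𝒪] BigRepModule 𝒪 p A) ↔
      ∃ (a : A) (h : (fun _ : ℤ_[p] ↦ a) ∈ bigRepSubmodule 𝒪 p A),
        Φ = BigRepModule.mk (fun _ : ℤ_[p] ↦ a) h := by
  rw [LinearMap.mem_ker]
  refine ⟨fun hΦ ↦ ⟨Φ 0, _, eq_mk_const_of_shiftSubOne_eq_zero Φ hΦ⟩, ?_⟩
  rintro ⟨a, h, rfl⟩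
  exact shiftSubOne_mk_const a h

variable [TopologicalSpace 𝒪] [TopologicalSpace A] [DiscreteTopology A] {G : Type*} [Group G]
  [TopologicalSpace G] [ContinuousMul G] [TopologicalSpace (PowerSeries 𝒪)]

/-- The `G`-action `ρ ⊗ Ψ⁻¹` on a CONSTANT function: `(g · const a)(x) = ρ(g)(a)` — on the constants
`A[p^∞] ↪ M`, `G` acts through `ρ`. [cite: Castella2018, §2.1 (𝒜 := T ⊗ Λ^*, G_K-action ρ ⊗ Ψ^{-1})] -/
theorem bigRep_mk_const_apply (κ : G →ₜ* Multiplicative ℤ_[p]) (ρ : ContinuousRep G 𝒪 A) (g : G)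
    (a : A) (h : (fun _ : ℤ_[p] ↦ a) ∈ bigRepSubmodule 𝒪 p A) (x : ℤ_[p]) :
    bigRep κ ρ g (BigRepModule.mk (fun _ : ℤ_[p] ↦ a) h) x = ρ g a := by
  rw [bigRep_apply_apply, BigRepModule.mk_apply]

/-- The `G`-action on a constant function is the constant function at the translated value:
`g · const a = const (ρ g a)`. [cite: Castella2018, §2.1 (𝒜 := T ⊗ Λ^*, G_K-action ρ ⊗ Ψ^{-1})] -/
theorem bigRep_mk_const (κ : G →ₜ* Multiplicative ℤ_[p]) (ρ : ContinuousRep G 𝒪 A) (g : G)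
    (a : A) (h : (fun _ : ℤ_[p] ↦ a) ∈ bigRepSubmodule 𝒪 p A) :
    bigRep κ ρ g (BigRepModule.mk (fun _ : ℤ_[p] ↦ a) h) =
      BigRepModule.mk (fun _ : ℤ_[p] ↦ ρ g a) (const_map_mem_bigRepSubmodule (ρ g) h) := by
  ext x
  rw [bigRep_mk_const_apply, BigRepModule.mk_apply]

/-- Pointwise form on a function that happens to be constant (e.g. the values of a cocycle killed by
`T`): `(g · Φ)(x) = ρ(g)(Φ 0)`. [cite: Castella2018, §2.1 (𝒜 := T ⊗ Λ^*, G_K-action ρ ⊗ Ψ^{-1})] -/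
theorem bigRep_apply_of_forall_apply_eq (κ : G →ₜ* Multiplicative ℤ_[p]) (ρ : ContinuousRep G 𝒪 A)
    (g : G) {Φ : BigRepModule 𝒪 p A} (hΦ : ∀ x, Φ x = Φ 0) (x : ℤ_[p]) :
    bigRep κ ρ g Φ x = ρ g (Φ 0) := by
  rw [bigRep_apply_apply, hΦ]

/-- The `G`-action commutes with `T = τ₁ - 1` (it is `Λ`-linear), so it preserves `M[T]`:
`T • (g · Φ) = g · (T • Φ)`. [cite: Castella2018, §2.1 (the G_K-action on the Λ-module 𝒜 is Λ-linear)] -/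
theorem shiftSubOne_bigRep_apply (κ : G →ₜ* Multiplicative ℤ_[p]) (ρ : ContinuousRep G 𝒪 A)
    (g : G) (Φ : BigRepModule 𝒪 p A) :
    shiftSubOne (bigRep κ ρ g Φ) = bigRep κ ρ g (shiftSubOne Φ) := by
  rw [← X_smul, ← X_smul, map_smul]

end Constants

/-! ### §2 Torsion bookkeeping: `T`-power and `p`-power torsion; `M[r] = A[r] ⊗ Λ^*` -/

section Torsion

/-- Every element of `M` is killed by a power of `T`, in `𝒪⟦T⟧`-currency (`T` is locally nilpotent,
`shiftSubOne_locNil`; sibling of `nilIndex_spec` + `shiftSubOne_pow_eq_X_pow_smul` in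
`Greenberg2006/CoinducedModuleDual.lean`, import-light and universe-polymorphic here).
[cite: GreenbergLNM1716, §4, proof of Prop. 4.10 (𝒜 = lim 𝒜[θ^{(n)}], θ^{(n)} = (1+T)^{p^n} − 1)] -/
theorem exists_X_pow_smul_eq_zero (Φ : BigRepModule 𝒪 p A) :
    ∃ n : ℕ, (PowerSeries.X : PowerSeries 𝒪) ^ n • Φ = 0 := by
  obtain ⟨n, hn⟩ := shiftSubOne_locNil (𝒪 := 𝒪) (p := p) (A := A) Φ
  refine ⟨n, ?_⟩
  have key : ∀ (m : ℕ) (Ψ : BigRepModule 𝒪 p A),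
      (PowerSeries.X : PowerSeries 𝒪) ^ m • Ψ = (shiftSubOne ^ m) Ψ := fun m ↦ by
    induction m with
    | zero => intro Ψ; rw [pow_zero, one_smul, pow_zero, Module.End.one_apply]
    | succ m ih => intro Ψ; rw [pow_succ, mul_smul, X_smul, ih, pow_succ, Module.End.mul_apply]
  rw [key, hn]

/-- Every element of `M` is killed by a power of `p`, in `𝒪⟦T⟧`-currency: by `C(p)^k` (`Λ^*` and
`T ⊗ Λ^*` are `p`-primary; the `ℕ`-form is `BigRepModule.exists_pow_nsmul_eq_zero` in
`Greenberg2006/CoinducedModuleDual.lean`). [cite: SkinnerUrban2014, §3.1.3 and proof of Prop. 3.2.3 (Λ^* = lim Hom(ℤ[Gal(F_n/F)], A^*), A^* the Pontrjagin dual)] -/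
theorem exists_C_natCast_pow_smul_eq_zero (Φ : BigRepModule 𝒪 p A) :
    ∃ k : ℕ, (PowerSeries.C (p : 𝒪) : PowerSeries 𝒪) ^ k • Φ = 0 := by
  obtain ⟨k, hk⟩ := Φ.exists_torsion
  refine ⟨k, ?_⟩
  rw [← map_pow, C_smul, ← Nat.cast_pow, Nat.cast_smul_eq_nsmul]
  ext x
  rw [BigRepModule.nsmul_apply, hk, BigRepModule.zero_apply]

variable {A' : Type*} [AddCommGroup A'] [Module 𝒪 A']

/-- **A function lies in the image of `L_* : A' ⊗ Λ^* → A ⊗ Λ^*` for an INJECTIVE `L : A' → A` iff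
all its values do** (preimages chosen pointwise; level of `Φ`, torsion transferred along `L`).
[cite: Castella2018Erratum, §2 p. 4 ((b): T_{g_m}/p^m T_{g_m} ≃ T/p^m T transported to M_g = T_g ⊗_𝒪 Λ_𝒪^*)] -/
theorem mem_range_mapRange_iff {L : A' →ₗ[𝒪] A} (hL : Function.Injective L)
    (Φ : BigRepModule 𝒪 p A) :
    Φ ∈ LinearMap.range (mapRange (p := p) L) ↔ ∀ x, Φ x ∈ LinearMap.range L := by
  constructor
  · rintro ⟨Ψ, rfl⟩ x
    exact ⟨Ψ x, rfl⟩
  · intro h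
    choose f hf using fun x ↦ LinearMap.mem_range.1 (h x)
    obtain ⟨n, hn⟩ := Φ.exists_level
    obtain ⟨k, hk⟩ := Φ.exists_torsion
    refine ⟨BigRepModule.mk f ⟨⟨n, fun x y hxy ↦ hL ?_⟩, ⟨k, fun x ↦ hL ?_⟩⟩, ?_⟩
    · rw [hf, hf]
      exact hn x y hxy
    · rw [map_nsmul, hf, map_zero]
      exact hk x
    · refine BigRepModule.ext fun x ↦ ?_
      rw [mapRange_apply, BigRepModule.mk_apply, hf]

/-- `r • Φ = 0` iff every value of `Φ` is killed by `r`. [cite: Castella2018Erratum, §2 and Lemma 2.1 (p. 2: M_g[ϖ^m] ⊂ M_g)] -/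
theorem smul_eq_zero_iff_forall (r : 𝒪) (Φ : BigRepModule 𝒪 p A) :
    r • Φ = 0 ↔ ∀ x, r • Φ x = 0 := by
  refine ⟨fun h x ↦ ?_, fun h ↦ BigRepModule.ext fun x ↦ ?_⟩
  · rw [← BigRepModule.smul_apply, h, BigRepModule.zero_apply]
  · rw [BigRepModule.smul_apply, h, BigRepModule.zero_apply]

/-- **`M[r] = A[r] ⊗ Λ^*`**: the `r`-torsion of the big module is the image of the big module of
`A[r]` under the injective (`mapRange_injective`) map induced by `A[r] ↪ A` (`r = p`: `M[p]`).
[cite: Castella2018Erratum, §2 and Lemma 2.1 (p. 2: "Sel(K, M_g[ϖ^m])", "the inclusion M_g[ϖ^m] ⊂ M_g")] -/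
theorem range_mapRange_subtype_torsionBy (r : 𝒪) :
    LinearMap.range (mapRange (p := p) (Submodule.torsionBy 𝒪 A r).subtype) =
      Submodule.torsionBy 𝒪 (BigRepModule 𝒪 p A) r := by
  ext Φ
  rw [mem_range_mapRange_iff (Submodule.torsionBy 𝒪 A r).injective_subtype,
    Submodule.mem_torsionBy_iff, smul_eq_zero_iff_forall]
  refine forall_congr' fun x ↦ ?_
  rw [Submodule.range_subtype, Submodule.mem_torsionBy_iff]

end Torsion

end Literature.NumberTheory.EllipticCurves.BigRepModule
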